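import Mathlib
import Summits.ResolutionOfSingularities.ResolutionOfSingularities.Theorems.RadicialJungCleanModelsCleanCurveChainTau
import Summits.ResolutionOfSingularities.ResolutionOfSingularities.Theorems.RadicialJungCleanModelsL7bGlobalCleanPermSeq
import Summits.ResolutionOfSingularities.ResolutionOfSingularities.Theorems.RadicialJungCleanModelsCleanTauTwoSlice
import Summits.ResolutionOfSingularities.ResolutionOfSingularities.Theorems.RadicialJungCleanModelsGenericSpreadSchemeFinite
import Summits.ResolutionOfSingularities.ResolutionOfSingularities.Theorems.RadicialJungCleanModelsCurveDimensionData
import Summits.ResolutionOfSingularities.ResolutionOfSingularities.Theorems.MarkedTransferCampaignW46ThreefoldsCurveSliceClosedPoints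
import Literature.AlgebraicGeometry.Resolution.TransverseCentreEffectiveCartier
import HarnessLib

/-!
# Route `RadicialJung`, crux `CleanModels` (stmt-ResolutionOfSingularities-15917), line `Sketch` rev 35, stub 6 `stub_cleanProp44` (X44c):
# THE CLEAN REGULAR-CURVE SLICE WITH `τ ≥ 2` AT THE CLOSED POINTS — PROVED (no births over `τ ≥ 2` points)

The hypothesis `hcurve` of the clean assembly ✓ `cleanProp44_of_cleanPieces` (`…CleanProp44OfPieces.lean`) in the sub-case «`τ ≥ 2` at the closed points of the
curve» is a THEOREM: L7b-global (✓ `exists_isCleanPermissibleSeq_forall_cleanPermissibleAt_of_ncard_le`, re-run here with the two invariants of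
✓ `IsPointChainAlong.isCleanPermissibleSeq_tau`: the bad locus over `V` stays ON the strict transform, `τ ≥ 2` persists) makes the curve clean-permissible
without creating any new point of order `μ` over `V`; then ONE blowing up of the (clean-permissible) strict transform leaves no point of order `≥ μ` over
it (✓ `CampaignW46.IsBlowup.idealOrder_lt_of_curve_closedPoints`, [CoP1] Lemma 4.3 (2)), and the clean end game (✓ `exists_isCleanPermissibleSeq_lt_opens_of_seq`)
reads the conclusion of X44c on `V`.

* `exists_isCleanPermissibleSeq_forall_cleanPermissibleAt_bad_of_ncard_le` — L7b-global with the two invariants.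
* `exists_isCleanPermissibleSeq_lt_comap_of_curve_two_le_tau` — **THE CLEAN REGULAR-CURVE SLICE, `τ ≥ 2` at closed points** (binders of the
  assembly's `hcurve` plus `∀ y ∈ Y, IsClosed {y} → τ_y ≥ 2`).

So the research residual of X44c is confined to `τ = 1`: the clean `τ = 1` isolated-point slice, the clean regular-curve slice through a `τ = 1` point, and
clean reach-tidy (Phase II) — exactly where [CoP1]'s own proof needs T1 / Lemma 4.5, and where the births (B′)/(B5′) of memo 4e §2.4–2.6 live.

Honest framing: OURS; nothing here proves X44c, any case of `CleanModels`, or resolution of singularities in characteristic `p`.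
-/

noncomputable section

set_option linter.dupNamespace false -- mandated namespace of this single-conjunct summit

open CategoryTheory AlgebraicGeometry TopologicalSpace IsLocalRing Opposite
open Literature.AlgebraicGeometry.Resolution Literature.AlgebraicGeometry.Motives
open Scheme.IdealSheafData

namespace Summit.ResolutionOfSingularities.ResolutionOfSingularities.Theorems.RadicialJung.CleanModels

set_option maxHeartbeats 800000 in
-- long binder lists, as in the L7b-global original
/-- **L7b-global along a `τ ≥ 2` curve, with the two invariants** (re-run of ✓ `exists_isCleanPermissibleSeq_forall_cleanPermissibleAt_of_ncard_le` over
✓ `IsPointChainAlong.isCleanPermissibleSeq_tau`): additionally, IN: `μ ≥ 1`, an open `V ⊆ X₁` with `{ord J₁ ≥ μ} ⊆ C₀ ∪ (X₁ ∖ V)`, and `τ ≥ 2` at the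
closed points of `C₀`; OUT: `{ord J' ≥ μ} ⊆ C ∪ σ⁻¹(X₁ ∖ V)` and `τ ≥ 2` at the closed points of the strict transform `C`.
[cite: CossartPiltant2008, Prop. 4.4 (proof, p. 10); Lemma 4.3 (1) (3)] [cite: Piltant2013, §2 Axiom 4] -/
theorem exists_isCleanPermissibleSeq_forall_cleanPermissibleAt_bad_of_ncard_le (p : ℕ) [hp : Fact p.Prime] (N : ℕ) :
    ∀ {X X₁ : Scheme.{0}} [IsIntegral X] [IsIntegral X₁] [IsNoetherian X₁] {π : X₁ ⟶ X} [IsDominant π] {J : X.IdealSheafData} {μ : ℕ}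
      (_ : 1 ≤ μ) {J₁ : X₁.IdealSheafData} {G : X.functionField} [CharP X.functionField p] (_ : IsCleanPermissibleSeq p π J μ J₁ G)
      (_ : ∀ x : X, CleanRegAt p (algebraMap (X.presheaf.stalk x) X.functionField) G)
      (_ : Scheme.IsRegular X₁) (_ : Scheme.IsQuasiExcellent X₁) (_ : ∀ x : X₁, idealOrder J₁ x ≤ μ) {C₀ : Closeds X₁}
      (_ : ∀ y ∈ (C₀ : Set X₁), ∃ c : Fin 2 → X₁.presheaf.stalk y, IsRsopPart c ∧ Ideal.span (Set.range c) = stalkIdeal (vanishingIdeal C₀) y)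
      {η : X₁} (_ : (C₀ : Set X₁) = closure {η}) (_ : ∀ y ∈ (C₀ : Set X₁), y ≠ η → IsClosed ({y} : Set X₁))
      (_ : ∀ y ∈ (C₀ : Set X₁), y ≠ η → ringKrullDim (X₁.presheaf.stalk y) = 3) (_ : ∀ y ∈ (C₀ : Set X₁), idealOrder J₁ y = μ)
      (V : X₁.Opens) (_ : ∀ z : X₁, (μ : ℕ∞) ≤ idealOrder J₁ z → z ∈ (C₀ : Set X₁) ∨ z ∉ (V : Set X₁))
      (_ : ∀ y ∈ (C₀ : Set X₁), IsClosed ({y} : Set X₁) → ∀ hr : IsRegularLocalRing (X₁.presheaf.stalk y), 2 ≤ @stalkTau X₁ J₁ y hr μ)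
      (G₁ : X₁.functionField) (_ : G₁ = RatFn.functionFieldMap π G)
      (_ : {y : X₁ | y ∈ (C₀ : Set X₁) ∧ ¬ CleanPermissibleAt p (RatFn.toFunctionField y) G₁ (stalkIdeal (vanishingIdeal C₀) y)}.Finite)
      (_ : {y : X₁ | y ∈ (C₀ : Set X₁) ∧ ¬ CleanPermissibleAt p (RatFn.toFunctionField y) G₁ (stalkIdeal (vanishingIdeal C₀) y)}.ncard ≤ N),
    ∃ (X' : Scheme.{0}) (_ : IsIntegral X') (_ : IsNoetherian X') (σ : X' ⟶ X₁) (_ : IsDominant σ) (C : Closeds X') (η' : X')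
      (J' : X'.IdealSheafData),
      IsCleanPermissibleSeq p (σ ≫ π) J μ J' G ∧ IsProper σ ∧ Scheme.IsRegular X' ∧ Scheme.IsQuasiExcellent X' ∧
      (∀ y ∈ (C : Set X'), ∃ c : Fin 2 → X'.presheaf.stalk y, IsRsopPart c ∧ Ideal.span (Set.range c) = stalkIdeal (vanishingIdeal C) y) ∧
      (C : Set X') = closure {η'} ∧ σ η' = η ∧ (∀ x' : X', idealOrder J' x' ≤ μ) ∧ (∀ y ∈ (C : Set X'), idealOrder J' y = μ) ∧
      (∀ y ∈ (C : Set X'), CleanPermissibleAt p (RatFn.toFunctionField y) (RatFn.functionFieldMap σ G₁) (stalkIdeal (vanishingIdeal C) y)) ∧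
      (∀ z : X', (μ : ℕ∞) ≤ idealOrder J' z → z ∈ (C : Set X') ∨ σ z ∉ (V : Set X₁)) ∧
      (∀ y ∈ (C : Set X'), IsClosed ({y} : Set X') → ∀ hr : IsRegularLocalRing (X'.presheaf.stalk y), 2 ≤ @stalkTau X' J' y hr μ) := by
  induction N with
  | zero =>
    intro X X₁ _ _ _ π _ J μ hm J₁ G _ hπ hG hX₁ hE₁ hJ₁le C₀ hC₀reg η hη hcl hdim3 hC₀μ V hbadV hτC₀ G₁ hG₁ hfin hN
    have hgood : ∀ y ∈ (C₀ : Set X₁), CleanPermissibleAt p (RatFn.toFunctionField y) G₁ (stalkIdeal (vanishingIdeal C₀) y) := by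
      intro y hy
      by_contra hbad
      have h0 := (Set.ncard_eq_zero hfin).mp (Nat.le_zero.mp hN)
      have hmem : y ∈ {y : X₁ | y ∈ (C₀ : Set X₁) ∧
          ¬ CleanPermissibleAt p (RatFn.toFunctionField y) G₁ (stalkIdeal (vanishingIdeal C₀) y)} := ⟨hy, hbad⟩
      rw [h0] at hmem
      exact hmem
    refine ⟨X₁, inferInstance, inferInstance, 𝟙 X₁, inferInstance, C₀, η, J₁, by simpa using hπ, inferInstance, hX₁, hE₁, hC₀reg, hη, rfl,
      hJ₁le, hC₀μ, ?_, fun z hz => by simpa using hbadV z hz, hτC₀⟩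
    intro y hy
    rw [RatFn.functionFieldMap_id, RingHom.id_apply]
    exact hgood y hy
  | succ N ih =>
    intro X X₁ _ _ _ π _ J μ hm J₁ G _ hπ hG hX₁ hE₁ hJ₁le C₀ hC₀reg η hη hcl hdim3 hC₀μ V hbadV hτC₀ G₁ hG₁ hfin hN
    classical
    haveI : CharP X₁.functionField p := charP_of_injective_ringHom (RatFn.functionFieldMap π).injective p
    have hclean : ∀ x : X₁, CleanRegAt p (RatFn.toFunctionField x) G₁ := by
      intro x; rw [hG₁]; exact hπ.cleanRegAt hp.out inferInstance hG x
    have hηgood : CleanPermissibleAt p (RatFn.toFunctionField η) G₁ (stalkIdeal (vanishingIdeal C₀) η) :=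
      cleanPermissibleAt_genericPoint_of_cleanRegAt p hη G₁ (hclean η)
    by_cases hle : {y : X₁ | y ∈ (C₀ : Set X₁) ∧
        ¬ CleanPermissibleAt p (RatFn.toFunctionField y) G₁ (stalkIdeal (vanishingIdeal C₀) y)}.ncard ≤ N
    · exact ih hm hπ hG hX₁ hE₁ hJ₁le hC₀reg hη hcl hdim3 hC₀μ V hbadV hτC₀ G₁ hG₁ hfin hle
    have hne : {y : X₁ | y ∈ (C₀ : Set X₁) ∧
        ¬ CleanPermissibleAt p (RatFn.toFunctionField y) G₁ (stalkIdeal (vanishingIdeal C₀) y)}.Nonempty := by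
      rw [Set.nonempty_iff_ne_empty]
      intro h0
      apply hle
      rw [h0, Set.ncard_empty]; exact Nat.zero_le _
    obtain ⟨x₀, hx₀C, hx₀bad⟩ := hne
    have hx₀η : x₀ ≠ η := by rintro rfl; exact hx₀bad hηgood
    -- the descent step: one chain at `x₀`
    obtain ⟨X₂, hX₂i, hX₂n, σ₁, hσ₁d, C₁, x₁, n₁, hchain, hσx, hx₁cl, hx₁good, hfin₁, hlt⟩ :=
      exists_pointChain_good_ncard_bad_lt hX₁ hE₁ p hC₀reg hη hcl hdim3 G₁ hfin hx₀C hx₀η hx₀bad (hclean x₀)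
    subst hσx
    have hx₀cl : IsClosed ({σ₁ x₁} : Set X₁) := hcl _ hx₀C hx₀η
    have hdim₀ : ringKrullDim (X₁.presheaf.stalk (σ₁ x₁)) = 3 := hdim3 _ hx₀C hx₀η
    have h0 : σ₁ x₁ ∈ closure ((C₀ : Set X₁) \ {σ₁ x₁}) := by
      have hsub : ({η} : Set X₁) ⊆ (C₀ : Set X₁) \ {σ₁ x₁} := by
        rintro z hz
        rw [Set.mem_singleton_iff] at hz
        subst hz
        exact ⟨by rw [hη]; exact subset_closure rfl, fun heq => hx₀η (Set.mem_singleton_iff.mp heq).symm⟩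
      have h1 := closure_mono hsub
      rw [← hη] at h1
      exact h1 hx₀C
    obtain ⟨hX₂, hC₁reg, -, -⟩ := data_along_pointChain hchain hX₁ hC₀reg hx₀C hdim₀
    have hE₂ : Scheme.IsQuasiExcellent X₂ := hchain.isQuasiExcellent hE₁
    obtain ⟨η₁, hη₁C, hση₁, hη₁, hcl₁, hdim3₁, hoff⟩ := hchain.curve_data hX₁ hC₀reg hη hcl hdim3 hx₀C hx₀η hx₁cl p G₁
    -- the chain is a legal extension of the clean-permissible sequence, AND HARMLESS
    obtain ⟨_, _, J₂, hseq₂, hJ₂le, hC₁μ, hoffJ, hfib, hpre, hτC₁⟩ :=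
      hchain.isCleanPermissibleSeq_tau hp.out hm hπ hG hX₁ hE₁ hJ₁le hC₀reg hC₀μ hτC₀ hx₀C hdim₀ hx₀cl h0
    haveI : IsProper σ₁ := hchain.isProper
    haveI : CompactSpace X₂ := QuasiCompact.compactSpace_of_compactSpace σ₁
    haveI : IsNoetherian X₂ := {}
    have hG₂ : RatFn.functionFieldMap σ₁ G₁ = RatFn.functionFieldMap (σ₁ ≫ π) G := by
      rw [hG₁, RatFn.functionFieldMap_comp π σ₁, RingHom.comp_apply]
    have hN₁ : {y : X₂ | y ∈ (C₁ : Set X₂) ∧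
        ¬ CleanPermissibleAt p (RatFn.toFunctionField y) (RatFn.functionFieldMap σ₁ G₁) (stalkIdeal (vanishingIdeal C₁) y)}.ncard ≤ N := by
      omega
    -- the invariant «bad locus on the strict transform or off `V`» on `X₂`, for the transported open `σ₁⁻¹ V`
    have hbadV₂ : ∀ z : X₂, (μ : ℕ∞) ≤ idealOrder J₂ z → z ∈ (C₁ : Set X₂) ∨ z ∉ ((σ₁ ⁻¹ᵁ V : X₂.Opens) : Set X₂) := by
      intro z hz
      by_cases hzx : σ₁ z = σ₁ x₁
      · exact Or.inl (hfib z hzx hz)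
      · have hz' : (μ : ℕ∞) ≤ idealOrder J₁ (σ₁ z) := by rw [← hoffJ z hzx]; exact hz
        rcases hbadV (σ₁ z) hz' with h | h
        · exact Or.inl (hpre z hzx h)
        · exact Or.inr h
    obtain ⟨X₃, hX₃i, hX₃n, σ₂, hσ₂d, C₂, η₂, J₃, hseq₃, hprop₃, hX₃, hE₃, hC₂reg, hη₂, hση₂, hJ₃le, hC₂μ, hall, hbad₃, hτC₂⟩ :=
      ih hm hseq₂ hG hX₂ hE₂ hJ₂le hC₁reg hη₁ hcl₁ hdim3₁ hC₁μ (σ₁ ⁻¹ᵁ V) hbadV₂ hτC₁ (RatFn.functionFieldMap σ₁ G₁) hG₂ hfin₁ hN₁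
    haveI := hprop₃
    refine ⟨X₃, hX₃i, hX₃n, σ₂ ≫ σ₁, inferInstance, C₂, η₂, J₃, by simpa only [Category.assoc] using hseq₃, inferInstance, hX₃, hE₃, hC₂reg,
      hη₂, ?_, hJ₃le, hC₂μ, ?_, fun z hz => ?_, hτC₂⟩
    · rw [Scheme.Hom.comp_apply, hση₂, hση₁]
    · intro y hy
      rw [RatFn.functionFieldMap_comp σ₁ σ₂, RingHom.comp_apply]
      exact hall y hy
    · rcases hbad₃ z hz with h | h
      · exact Or.inl h
      · right
        rwa [Scheme.Hom.comp_apply]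

set_option maxHeartbeats 800000 in
-- long binder lists
/-- **THE CLEAN REGULAR-CURVE SLICE WITH `τ ≥ 2` AT THE CLOSED POINTS.**  `X` integral Noetherian regular quasi-excellent of dimension `≤ 3`,
`char K(X) = p`, the line of `G` clean-regular at every point; `J`, `m ≥ 1`, `ord ≤ m`, `V(J)` of codimension `≥ 2`; `V ⊆ X` open (non-empty) and
`Y ⊆ V` an irreducible closed regular curve (regular pair generating `(𝓘_Y)_y` at every point), `Y ⊆ {ord = m}`, every point of order `≥ m` on `Y` or
outside `V`, and `τ_y(J, m) ≥ 2` at the CLOSED points `y ∈ Y`.  Then the conclusion of X44c holds on `V`: some CLEAN-permissible sequence for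
`(J|_V, m)` and the line of `G|_V` brings the order below `m` (L7b insertions at the bad points of `Y` — harmless —, then the blowing up of the
clean-permissible strict transform). [cite: CossartPiltant2008, Lemma 4.3 (2) (3); Prop. 4.4 (proof, p. 10)] [cite: Piltant2013, §2 Axiom 4] -/
theorem exists_isCleanPermissibleSeq_lt_comap_of_curve_two_le_tau {p : ℕ} (hp : p.Prime) {X : Scheme.{0}} [IsIntegral X] [IsNoetherian X]
    [CharP X.functionField p] (hX : Scheme.IsRegular X) (hqe : Scheme.IsQuasiExcellent X) (hX3 : topologicalKrullDim X ≤ 3)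
    (G : X.functionField) (hG : ∀ x : X, CleanRegAt p (algebraMap (X.presheaf.stalk x) X.functionField) G)
    (J : X.IdealSheafData) {m : ℕ} (hm : 1 ≤ m) (hle : ∀ z, idealOrder J z ≤ m)
    (V : X.Opens) (Y : Closeds X) (hirr : IsIrreducible (Y : Set X)) (_hYV : (Y : Set X) ⊆ (V : Set X))
    (hJY : ∀ z : X, (m : ℕ∞) ≤ idealOrder J z → z ∈ (Y : Set X) ∨ z ∉ (V : Set X))
    (hord : ∀ y ∈ (Y : Set X), idealOrder J y = m)
    (hcurve : ∀ y ∈ (Y : Set X), haveI := hX y; ∃ c : Fin 2 → X.presheaf.stalk y, IsRsopPart c ∧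
      Ideal.span (Set.range c) = stalkIdeal (vanishingIdeal Y) y)
    (hτ2 : ∀ y ∈ (Y : Set X), IsClosed ({y} : Set X) → haveI := hX y; 2 ≤ stalkTau J y m)
    [IsIntegral ((V : X.Opens) : Scheme.{0})] [IsDominant V.ι] :
    ∃ (V' : Scheme.{0}) (π : V' ⟶ V) (_ : IsIntegral V') (_ : IsDominant π) (K' : V'.IdealSheafData),
      IsCleanPermissibleSeq p π (J.comap V.ι) m K' (RatFn.functionFieldMap V.ι G) ∧ ∀ y, idealOrder K' y < m := by
  classical
  haveI : Fact p.Prime := ⟨hp⟩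
  -- the curve: generic point, closed points of dimension `3`
  obtain ⟨η, hηgen⟩ := QuasiSober.sober hirr Y.isClosed
  have hη : (Y : Set X) = closure {η} := hηgen.symm
  have hX3' : ∀ x : X, ringKrullDim (X.presheaf.stalk x) ≤ 3 := fun x => by
    have h1 : ringKrullDim (X.presheaf.stalk x) ≤ topologicalKrullDim X := by
      rw [Literature.AlgebraicGeometry.Motives.Scheme.topologicalKrullDim_eq_iSup_ringKrullDim_stalk]
      exact le_iSup (fun x : X => ringKrullDim (X.presheaf.stalk x)) x
    exact h1.trans hX3
  have hYreg : ∀ y ∈ (Y : Set X), ∃ c : Fin 2 → X.presheaf.stalk y, IsRsopPart c ∧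
      Ideal.span (Set.range c) = stalkIdeal (vanishingIdeal Y) y := fun y hy => hcurve y hy
  obtain ⟨hdimη, hcl, hdim3⟩ := curve_dimension_data hX3' hYreg hη
  have hτY : ∀ y ∈ (Y : Set X), IsClosed ({y} : Set X) → ∀ hr : IsRegularLocalRing (X.presheaf.stalk y), 2 ≤ @stalkTau X J y hr m :=
    fun y hy hycl hr => hτ2 y hy hycl
  -- the bad set of `Y` is finite
  have hfin := finite_setOf_not_cleanPermissibleAt_of_cleanRegAt_genericPoint hX hqe p hYreg hη hdimη hcl G (hG η)
  -- L7b-global with the invariants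
  obtain ⟨X', hX'i, hX'n, σ, hσd, C, η', J', hseq, hprop, hX', hE', hCreg, hη', hση', hJ'le, hCμ, hperm, hbad', hτC⟩ :=
    exists_isCleanPermissibleSeq_forall_cleanPermissibleAt_bad_of_ncard_le p _ hm (IsCleanPermissibleSeq.nil J m G) hG hX hqe hle hYreg hη
      hcl hdim3 hord V hJY hτY G (by rw [RatFn.functionFieldMap_id, RingHom.id_apply]) hfin le_rfl
  haveI := hX'i
  haveI := hX'n
  haveI := hσd
  -- blow up the clean-permissible strict transform `C`
  have hCint : IsIntegral (vanishingIdeal C).subscheme :=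
    ComponentGluing.isIntegral_subscheme_vanishingIdeal C (by rw [hη']; exact isIrreducible_singleton.closure)
  have hCreg' : Scheme.IsRegular (vanishingIdeal C).subscheme :=
    isRegular_subscheme_vanishingIdeal_of_forall_isRsopPart fun y hy => by
      obtain ⟨c, hc, hspan⟩ := hCreg y hy
      exact ⟨2, c, hc, hspan⟩
  have hCbot : vanishingIdeal C ≠ ⊥ := by
    intro hbot
    have hηC : η' ∈ (C : Set X') := by rw [hη']; exact subset_closure rfl
    obtain ⟨c, hc, hspan⟩ := hCreg η' hηC
    haveI := hc.1
    have hc0 : c 0 ∈ stalkIdeal (vanishingIdeal C) η' := hspan ▸ Ideal.subset_span ⟨0, rfl⟩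
    rw [hbot, stalkIdeal_bot, Ideal.mem_bot] at hc0
    exact hc.ne_zero 0 hc0
  set τC := blowup.π (vanishingIdeal C) with hτCdef
  have hτC' : IsBlowup τC (vanishingIdeal C) := blowup.isBlowup _
  haveI : IsIntegral (blowup (vanishingIdeal C)) := hτC'.isIntegral hCbot
  haveI : IsDominant τC := isDominant_of_isBlowup_of_ne_bot hτC' hCbot
  have hseq' : IsCleanPermissibleSeq p (τC ≫ σ ≫ 𝟙 X) J m (controlledTransform τC (vanishingIdeal C) J' m) G := by
    refine IsCleanPermissibleSeq.cons τC (σ ≫ 𝟙 X) J m J' G C hseq hCint hCreg' hCμ hτC' fun y hy => ?_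
    have h1 := hperm y hy
    rw [Picover.FunctionFieldNormalizationIn.functionFieldMap_congr (Category.comp_id σ)]
    exact h1
  -- no point of order `≥ m` over `V` upstairs
  have hnone : ∀ z : blowup (vanishingIdeal C), (m : ℕ∞) ≤ idealOrder (controlledTransform τC (vanishingIdeal C) J' m) z →
      (τC ≫ σ ≫ 𝟙 X) z ∉ (V : Set X) := by
    intro z hz
    by_cases hzC : τC z ∈ (C : Set X')
    · -- over the curve: Lemma 4.3 (2) forbids order `≥ m`
      have hlt := CampaignW46.IsBlowup.idealOrder_lt_of_curve_closedPoints hX' J' hm C hCreg' hCμ (fun y hy hycl => ?_) hτC' hzC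
      · exact absurd hz (not_le.mpr hlt)
      · obtain ⟨c, hc, hspan⟩ := hCreg y hy
        exact ⟨c, hc, hspan, hτC y hy hycl (hX' y)⟩
    · -- off the curve: the order is that of `J'`, and such points lie off `V`
      have hz' : τC z ∉ ((vanishingIdeal C).support : Set X') := by
        rw [Scheme.IdealSheafData.coe_support_vanishingIdeal]; exact hzC
      rw [hτC'.idealOrder_controlledTransform_of_not_mem J' m hz'] at hz
      rcases hbad' (τC z) hz with h | h
      · exact absurd h hzC
      · rw [Scheme.Hom.comp_apply, Scheme.Hom.comp_apply]
        simpa using h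
  exact exists_isCleanPermissibleSeq_lt_opens_of_seq hseq' V hnone

end Summit.ResolutionOfSingularities.ResolutionOfSingularities.Theorems.RadicialJung.CleanModels

end
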